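import Mathlib.Combinatorics.SimpleGraph.DeleteEdges
import Mathlib.SetTheory.Cardinal.Finite
import Literature.Probability.LatticeModels.RootedSpanningForests
import HarnessLib

/-!
# Rooted spanning forests: changing the graph off the roots, and splitting along one edge

Topic `Probability/LatticeModels`; namespace `Literature.Probability.LatticeModels.Forest`.
Generic complements to `RootedSpanningForests.lean` (rooted spanning forests of a finite graph
as parent maps), used by the deletion–contraction recursion for the number of spanning trees
containing a prescribed boundary arc (`USTPeanoPrimalGraph.lean`; [LSW04] §4.1):

* `Forest.adjEquiv` — forests rooted at `R` only see the edges with a non-root endpoint: two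
  graphs that agree on those have the same forests; `Forest.castRoots` — equal root sets;
* `Forest.splitParent` — splitting the forests according to the parent of one vertex `v`;
* `Forest.parentEqEquiv` — **contraction**: for an edge `v ~ u` from a non-root `v` to a root
  `u`, the forests in which `u` is the parent of `v` are the forests rooted at `R ∪ {v}`
  (restriction / gluing of the one-edge branch `[v, u]`);
* `Forest.parentNeEquiv` — **deletion**: the forests in which `u` (a root) is not the parent of
  `v` are the forests of the graph with the edge `{v, u}` deleted.

Together: `|Forest H R| = |Forest H (R ∪ {v})| + |Forest (H - vu) R|`, the rooted form of the
deletion–contraction recursion for spanning trees (e.g. Lyons–Peres (2016), §4.1, proof sketch of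
the existence of spanning trees; Grimmett (2018), §2.2).

## References

* R. Lyons, Y. Peres, *Probability on Trees and Networks*, CUP (2016), §4.1. [LyonsPeres2016]
-/

namespace Literature.Probability.LatticeModels

open Literature.Probability.RandomPlanarGeometry
open RootedForest

namespace Forest

variable {V : Type*} {H H' : SimpleGraph V} {R R' : Finset V}

/-! ### Changing the graph and the root set -/

/-- Transport a forest along an implication of adjacencies from non-roots. [folklore] -/
def mapAdj (hadj : ∀ ⦃u v : V⦄, u ∉ R → H.Adj u v → H'.Adj u v) (F : Forest H R) : Forest H' R where
  parent := F.parent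
  adj _ hu := hadj hu (F.adj hu)
  root := F.root
  exists_rank := F.exists_rank

/-- The parent map is unchanged by `mapAdj`. [folklore] -/
@[simp] theorem mapAdj_parent (hadj : ∀ ⦃u v : V⦄, u ∉ R → H.Adj u v → H'.Adj u v)
    (F : Forest H R) : (F.mapAdj hadj).parent = F.parent := rfl

/-- **Forests only see the edges with a non-root endpoint**: two graphs whose adjacencies from
non-roots agree have the same forests rooted at `R`. [folklore] -/
def adjEquiv (hadj : ∀ ⦃u v : V⦄, u ∉ R → (H.Adj u v ↔ H'.Adj u v)) : Forest H R ≃ Forest H' R where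
  toFun := mapAdj fun _ _ hu h ↦ (hadj hu).1 h
  invFun := mapAdj fun _ _ hu h ↦ (hadj hu).2 h
  left_inv _ := Forest.ext rfl
  right_inv _ := Forest.ext rfl

/-- The parent map is unchanged by `adjEquiv`. [folklore] -/
@[simp] theorem adjEquiv_parent (hadj : ∀ ⦃u v : V⦄, u ∉ R → (H.Adj u v ↔ H'.Adj u v))
    (F : Forest H R) : (adjEquiv hadj F).parent = F.parent := rfl

/-- Forests along an equality of root sets. [folklore] -/
def castRoots (h : R = R') : Forest H R ≃ Forest H R' := h ▸ Equiv.refl _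

/-- The parent map is unchanged by `castRoots`. [folklore] -/
@[simp] theorem castRoots_parent (h : R = R') (F : Forest H R) :
    (castRoots h F).parent = F.parent := by
  subst h
  rfl

/-- The parent map is unchanged by the inverse of `castRoots`. [folklore] -/
@[simp] theorem castRoots_symm_parent (h : R = R') (F : Forest H R') :
    ((castRoots h).symm F).parent = F.parent := by
  subst h
  rfl

/-! ### Splitting along the parent of one vertex -/

open Classical in
/-- Splitting the forests according to whether `u` is the parent of `v`. [folklore] -/
noncomputable def splitParent (v u : V) :
    Forest H R ≃ ({F : Forest H R // F.parent v = u} ⊕ {F : Forest H R // F.parent v ≠ u}) :=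
  (Equiv.sumCompl fun F : Forest H R ↦ F.parent v = u).symm

variable [DecidableEq V]

/-- The root set after attaching the one-edge branch `[v, u]` to `R ∋ u` is `R ∪ {v}`.
[folklore] -/
theorem cov_pair_eq {v u : V} (hu : u ∈ R) : cov R v [u] = insert v R := by
  ext w
  simp only [mem_cov, List.mem_cons, List.not_mem_nil, or_false, Finset.mem_insert]
  constructor
  · rintro ((rfl | rfl) | h)
    · exact Or.inl rfl
    · exact Or.inr hu
    · exact Or.inr h
  · rintro (rfl | h)
    · exact Or.inl (Or.inl rfl)
    · exact Or.inr h

/-- **Contraction**: for an edge from a non-root `v` to a root `u`, the forests rooted at `R`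
in which `u` is the parent of `v` correspond to the forests rooted at `R ∪ {v}` (restrict;
conversely glue the one-edge branch `[v, u]`). [folklore] -/
noncomputable def parentEqEquiv {v u : V} (hv : v ∉ R) (hu : u ∈ R) (hadj : H.Adj v u) :
    {F : Forest H R // F.parent v = u} ≃ Forest H (insert v R) :=
  have hnd : (v :: [u]).Nodup := by simp [hadj.ne]
  have hst : IsStoppedAt (↑R : Set V) (v :: [u]) :=
    (isStoppedAt_singleton (by exact hu)).cons (by exact hv)
  have hch : List.IsChain H.Adj (v :: [u]) := List.isChain_pair.2 hadj
  { toFun := fun F ↦ F.1.restrict (insert v R) (Finset.subset_insert v R)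
    invFun := fun F' ↦ ⟨Forest.glue hnd hst hch ((castRoots (cov_pair_eq hu)).symm F'), by
      rw [glue_parent]
      exact glue_of_pathSucc _ (by simp [pathSucc_cons_cons])⟩
    left_inv := fun F ↦ by
      refine Subtype.ext (Forest.ext (funext fun w ↦ ?_))
      rw [glue_parent]
      by_cases hw : w = v
      · subst hw
        rw [glue_of_pathSucc (b := u) _ (by simp [pathSucc_cons_cons])]
        exact F.2.symm
      · rw [glue_of_not_mem _ (by simp [hw]), castRoots_symm_parent, restrict_parent]
        split_ifs with hwR
        · exact (F.1.root ((Finset.mem_insert.1 hwR).resolve_left hw)).symm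
        · rfl
    right_inv := fun F' ↦ by
      refine Forest.ext (funext fun w ↦ ?_)
      rw [restrict_parent]
      split_ifs with hwR
      · exact (F'.root hwR).symm
      · have hw : w ≠ v := fun h ↦ hwR (h ▸ Finset.mem_insert_self v R)
        rw [glue_parent, glue_of_not_mem _ (by simp [hw]), castRoots_symm_parent] }

/-- **Deletion**: for a root `u` and a vertex `v ≠ u`, the forests rooted at `R` in which `u`
is not the parent of `v` are the forests of the graph with the edge `{v, u}` deleted (no other
vertex can use that edge towards its parent, `u` being a root). [folklore] -/
def parentNeEquiv {v u : V} (hu : u ∈ R) (hvu : v ≠ u) :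
    {F : Forest H R // F.parent v ≠ u} ≃ Forest (H.deleteEdges {s(v, u)}) R where
  toFun F :=
    { parent := F.1.parent
      adj := fun w hw ↦ by
        rw [SimpleGraph.deleteEdges_adj]
        refine ⟨F.1.adj hw, fun h ↦ ?_⟩
        rw [Set.mem_singleton_iff, Sym2.eq_iff] at h
        rcases h with ⟨rfl, h2⟩ | ⟨rfl, -⟩
        · exact F.2 h2
        · exact hw hu
      root := F.1.root
      exists_rank := F.1.exists_rank }
  invFun F' :=
    ⟨{ parent := F'.parent
       adj := fun w hw ↦ ((SimpleGraph.deleteEdges_adj).1 (F'.adj hw)).1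
       root := F'.root
       exists_rank := F'.exists_rank }, by
      intro h
      by_cases hvR : v ∈ R
      · exact hvu ((F'.root hvR).symm.trans h)
      · have := ((SimpleGraph.deleteEdges_adj).1 (F'.adj hvR)).2
        rw [h] at this
        exact this (Set.mem_singleton _)⟩
  left_inv _ := Subtype.ext (Forest.ext rfl)
  right_inv _ := Forest.ext rfl

/-- **The deletion–contraction recursion for rooted spanning forests**: for an edge from a
non-root `v` to a root `u`,
`|Forest H R| = |Forest H (R ∪ {v})| + |Forest (H - {v,u}) R|`. [cite: LyonsPeres2016, §4.1] -/
theorem card_eq_card_insert_add_card_deleteEdges [Fintype V] {v u : V} (hv : v ∉ R) (hu : u ∈ R)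
    (hadj : H.Adj v u) :
    Nat.card (Forest H R) =
      Nat.card (Forest H (insert v R)) + Nat.card (Forest (H.deleteEdges {s(v, u)}) R) := by
  rw [Nat.card_congr (splitParent v u), Nat.card_sum, Nat.card_congr (parentEqEquiv hv hu hadj),
    Nat.card_congr (parentNeEquiv hu hadj.ne)]

end Forest

end Literature.Probability.LatticeModels
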